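import Literature.NumberTheory.Automorphic.AdelicThetaHeightBound
import Literature.NumberTheory.Automorphic.AdelicRowVectorTwist
import HarnessLib

/-!
# Theta TAIL sums decay along the archimedean ray: `Σ_{ξ ≠ 0} |Ψ((ξ L)/r)| ≤ r^θ · M G(L)^θ Z`

Topic `NumberTheory/Automorphic`; namespace `Literature.NumberTheory.Automorphic` (sequel of
★ `AdelicThetaHeightBound`).  KERNEL only: proved theorems, no definition, no named fact, no `sorry`.

★ `tsum_enorm_vecMul_le_of_decay` bounds the FULL theta sum `Σ_{ξ ∈ Kᴺ} |Ψ(ξ L)|` of a decaying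
function (`|Ψ(x)| ≤ M (1 + ‖x_∞‖)^{-k}`, `Ψ = 0` off a finite-adelic compact `C_f`) by
`M + M G^θ Z`, `G ≥ Σ_{k,l} ‖(L⁻¹)_{∞,kl}‖`, `Z = Σ_{ξ ≠ 0, ξ_f ∈ C'} ‖ξ_∞‖^{-θ}`; the constant `M` is the
term `ξ = 0`.  Here:
* §1 `tsum_enorm_vecMul_tail_le_of_decay` — **the TAIL `Σ_{ξ ≠ 0} |Ψ(ξ L)| ≤ M G^θ Z`** (no `ξ = 0` term);
* §2 the archimedean ray `L_r := L · z(r)⁻¹` (`z(r) = posRealScalar N K r`, the positive real scalar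
  matrix at the infinite places): `vecMul_mul_posRealScalar_inv` (`x L_r = z(r⁻¹) · (x L)`, i.e.
  `Ψ(ξ L_r) = Ψ((ξ L)/r)`), `vecFinitePart_vecMul_mul_posRealScalar_inv` (finite parts unchanged),
  `sum_norm_inv_arch_mul_posRealScalar_inv` (**`G(L_r) = r · G(L)`**);
* §4 `exists_tsum_enorm_vecMul_tail_ray_le_archHeight_rpow` — uniformly for `L_f` in a compact set:
  `Σ_{ξ ≠ 0} |Ψ(ξ L z(r)⁻¹)| ≤ r^θ · B · (1 ⊔ N² H_∞(L))^θ` (the ray version of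
  ★ `exists_tsum_enorm_vecMul_le_archHeight_rpow`);
* §3 `tsum_enorm_vecMul_tail_ray_le` — **THE TAIL DECAYS ALONG THE RAY**:
  `Σ_{ξ ≠ 0} |Ψ(ξ L_r)| ≤ r^θ · (M G^θ Z)` for every `r > 0` and `0 ≤ θ ≤ k` — so on the narrow ray
  `r → 0` the theta tail is `O(r^θ)` for every `θ ≤ k`, with the SAME `Z` (hence uniformly for `L`
  with `L_f` in a compact set and `G(L)` bounded, ★ `exists_isCompact_vecFinitePart_mem`).
This is the theta-side input of the boundedness step of the rank-one Siegel–Weil formula in Weil's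
convergent range ([Weil1965] n° 48 Lemma 21, n° 50 Thm. 4): on the narrow ray of the Levi torus the
positive theta-type measure `Î = Σ_b μ̂_b` (sums over `ξ ≠ 0`) evaluated on `ω(d(ι r))Ψ = Ψ(·/r)`
decays like `r^θ`, beating the modulus `l2Scaling^{1/2} = r^{N[K:ℚ]·…}` required by the normalised
bound.  Cell `hodgecm-mathlib`, FLOOR 0, E-2 desk, crux H413 (stmt-HodgeConjecture-24833), row
SW2c-BOUND (B); HC_CM is proved only modulo the printed citations until rung 0 closes; this file is
unconditional and touches no binder.

## References
* [Weil1965] A. Weil, *Sur la formule de Siegel dans la théorie des groupes classiques*, Acta Math.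
  113 (1965), n° 48 (Lemme 21), n° 50 (Thm. 4).
* [GodementJacquetLNM260] R. Godement, H. Jacquet, *Zeta functions of simple algebras*, LNM 260
  (1972), §11 (Lemma 11.5–11.6).
-/

set_option autoImplicit false

noncomputable section

open scoped NNReal ENNReal Pointwise Classical RestrictedProduct
open NumberField NumberField.mixedEmbedding IsDedekindDomain Set MeasureTheory Measure Matrix Module

namespace Literature.NumberTheory.Automorphic

variable (K : Type) [Field K] [NumberField K] {N : ℕ}

/-! ## §1 The tail of the theta sum of a decaying function -/

/-- **The TAIL of the theta sum of a decaying function, pointwise in `L`**: under the hypotheses of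
★ `tsum_enorm_vecMul_le_of_decay` (`|Ψ(x)| ≤ M (1 + ‖x_∞‖)^{-k}`, `Ψ = 0` unless `x_f ∈ C_f`,
`(ξ L)_f ∈ C_f ⇒ ξ_f ∈ C'`, `G ≥ Σ_{k,l} ‖(L⁻¹)_{∞,kl}‖`, `0 ≤ θ ≤ k`),
`Σ_{ξ ∈ Kᴺ ∖ 0} |Ψ(ξ L)| ≤ M G^θ · Σ_{ξ ≠ 0, ξ_f ∈ C'} ‖ξ_∞‖^{-θ}`. [cite: GodementJacquetLNM260, §11] -/
theorem tsum_enorm_vecMul_tail_le_of_decay {Ψ : (Fin N → AdeleRing (𝓞 K) K) → ℂ} {k : ℕ} {M : ℝ}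
    (hM0 : 0 ≤ M) (hM : ∀ x, ‖Ψ x‖ ≤ M * (1 + ‖vecInfinitePart K N x‖) ^ (-(k : ℝ)))
    {Cf : Set (Fin N → FiniteAdeleRing (𝓞 K) K)} (hCf : ∀ x, vecFinitePart K N x ∉ Cf → Ψ x = 0)
    {C' : Set (Fin N → FiniteAdeleRing (𝓞 K) K)} (L : GL (Fin N) (AdeleRing (𝓞 K) K))
    (hL : ∀ v : Fin N → K,
      vecFinitePart K N (ratVec K v ᵥ* (L : Matrix (Fin N) (Fin N) (AdeleRing (𝓞 K) K))) ∈ Cf →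
        vecFinitePart K N (ratVec K v) ∈ C')
    {G : ℝ} (hG0 : 0 < G)
    (hGL : (∑ k, ∑ l, ‖(((L⁻¹ : GL (Fin N) (AdeleRing (𝓞 K) K)) :
          Matrix (Fin N) (Fin N) (AdeleRing (𝓞 K) K)).map
            fun a => InfiniteAdeleRing.ringEquiv_mixedSpace K a.1) k l‖) ≤ G)
    {θ : ℝ} (hθ0 : 0 ≤ θ) (hθk : θ ≤ k) :
    ∑' v : ↥{v : Fin N → K | v ≠ 0},
        (‖Ψ (ratVec K (v : Fin N → K) ᵥ* (L : Matrix (Fin N) (Fin N) (AdeleRing (𝓞 K) K)))‖ₑ : ℝ≥0∞) ≤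
      ENNReal.ofReal (M * G⁻¹ ^ (-θ)) *
        ∑' v : ↥{v : Fin N → K | v ≠ 0 ∧ vecFinitePart K N (ratVec K v) ∈ C'},
          ENNReal.ofReal (‖vecInfinitePart K N (ratVec K (v : Fin N → K))‖ ^ (-θ)) := by
  set Λ : Set (Fin N → K) := {v : Fin N → K | v ≠ 0 ∧ vecFinitePart K N (ratVec K v) ∈ C'} with hΛ
  set A : ℝ≥0∞ := ENNReal.ofReal (M * G⁻¹ ^ (-θ)) with hA
  set F : (Fin N → K) → ℝ≥0∞ := fun v =>
    A * ENNReal.ofReal (‖vecInfinitePart K N (ratVec K v)‖ ^ (-θ)) with hF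
  -- pointwise bound for `v ≠ 0` (as in ★ `tsum_enorm_vecMul_le_of_decay`)
  have hpt : ∀ v : Fin N → K, v ≠ 0 →
      (‖Ψ (ratVec K v ᵥ* (L : Matrix (Fin N) (Fin N) (AdeleRing (𝓞 K) K)))‖ₑ : ℝ≥0∞) ≤
        Λ.indicator F v := by
    intro v hv
    by_cases hC : vecFinitePart K N (ratVec K v ᵥ* (L : Matrix (Fin N) (Fin N) (AdeleRing (𝓞 K) K))) ∈ Cf
    · have hvΛ : v ∈ Λ := ⟨hv, hL v hC⟩
      rw [indicator_of_mem hvΛ]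
      have hNpos : 0 < ‖vecInfinitePart K N (ratVec K v)‖ := by
        have h := norm_vecInfinitePart_ratVec_vecMul_pos K hv (1 : GL (Fin N) (AdeleRing (𝓞 K) K))
        rwa [Matrix.GeneralLinearGroup.coe_one, Matrix.vecMul_one] at h
      have hlow : G⁻¹ * ‖vecInfinitePart K N (ratVec K v)‖ ≤
          ‖vecInfinitePart K N (ratVec K v ᵥ* (L : Matrix (Fin N) (Fin N) (AdeleRing (𝓞 K) K)))‖ := by
        rw [inv_mul_le_iff₀ hG0]
        exact (norm_vecInfinitePart_ratVec_le_mul K v L).trans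
          (mul_le_mul_of_nonneg_right hGL (norm_nonneg _))
      exact enorm_le_ofReal_mul_ofReal hM0 (inv_pos.2 hG0)
        (le_mul_rpow_neg_mul_rpow_neg hM0 (hM _) (inv_pos.2 hG0) hNpos hlow hθ0 hθk)
    · rw [hCf _ hC, enorm_zero]
      exact zero_le
  have h2 : ∑' v : Fin N → K, Λ.indicator F v =
      A * ∑' v : Λ, ENNReal.ofReal (‖vecInfinitePart K N (ratVec K (v : Fin N → K))‖ ^ (-θ)) := by
    rw [← tsum_subtype Λ F]
    simp only [hF]
    exact ENNReal.tsum_mul_left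
  calc ∑' v : ↥{v : Fin N → K | v ≠ 0},
        (‖Ψ (ratVec K (v : Fin N → K) ᵥ* (L : Matrix (Fin N) (Fin N) (AdeleRing (𝓞 K) K)))‖ₑ : ℝ≥0∞)
      ≤ ∑' v : ↥{v : Fin N → K | v ≠ 0}, Λ.indicator F (v : Fin N → K) :=
        ENNReal.tsum_le_tsum fun v => hpt v v.2
    _ ≤ ∑' v : Fin N → K, Λ.indicator F v :=
        ENNReal.tsum_comp_le_tsum_of_injective Subtype.val_injective _
    _ = _ := h2

/-! ## §2 The archimedean ray `L_r = L · z(r)⁻¹` -/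

/-- `x (L z(r)⁻¹) = z(r⁻¹) · (x L)`: twisting by `L_r = L · z(r)⁻¹` is the twist by `L` followed by the
archimedean dilation `y ↦ y/r` (`z = posRealScalar`, ★ `units_smul_eq_vecMul_scalar`). [cite: Weil1965, n° 48] -/
theorem vecMul_mul_posRealScalar_inv (x : Fin N → AdeleRing (𝓞 K) K) (L : GL (Fin N) (AdeleRing (𝓞 K) K)) (r : ℝ≥0ˣ) :
    x ᵥ* ((L * (posRealScalar N K r)⁻¹ : GL (Fin N) (AdeleRing (𝓞 K) K)) : Matrix (Fin N) (Fin N) (AdeleRing (𝓞 K) K)) =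
      ((posRealIdele K r⁻¹ : (AdeleRing (𝓞 K) K)ˣ) : AdeleRing (𝓞 K) K) •
        (x ᵥ* (L : Matrix (Fin N) (Fin N) (AdeleRing (𝓞 K) K))) := by
  rw [Units.val_mul, ← Matrix.vecMul_vecMul, ← map_inv, units_smul_eq_vecMul_scalar]
  rfl

/-- The finite part of `x (L z(r)⁻¹)` is that of `x L` (`z(r)` is `1` at the finite places). [cite: Weil1965, n° 48] -/
theorem vecFinitePart_vecMul_mul_posRealScalar_inv (x : Fin N → AdeleRing (𝓞 K) K)
    (L : GL (Fin N) (AdeleRing (𝓞 K) K)) (r : ℝ≥0ˣ) :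
    vecFinitePart K N (x ᵥ* ((L * (posRealScalar N K r)⁻¹ : GL (Fin N) (AdeleRing (𝓞 K) K)) :
        Matrix (Fin N) (Fin N) (AdeleRing (𝓞 K) K))) =
      vecFinitePart K N (x ᵥ* (L : Matrix (Fin N) (Fin N) (AdeleRing (𝓞 K) K))) := by
  rw [vecMul_mul_posRealScalar_inv]
  funext i
  rw [vecFinitePart_apply, vecFinitePart_apply, Pi.smul_apply, smul_eq_mul,
    show ∀ a b : AdeleRing (𝓞 K) K, (a * b).2 = a.2 * b.2 from fun _ _ => rfl, posRealIdele_snd, one_mul]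

/-- **`G(L z(r)⁻¹) = r · G(L)`**: the size of `(L_r)_∞⁻¹ = r · L_∞⁻¹`. [cite: Weil1965, n° 48] -/
theorem sum_norm_inv_arch_mul_posRealScalar_inv (L : GL (Fin N) (AdeleRing (𝓞 K) K)) (r : ℝ≥0ˣ) :
    (∑ k, ∑ l, ‖((((L * (posRealScalar N K r)⁻¹)⁻¹ : GL (Fin N) (AdeleRing (𝓞 K) K)) :
        Matrix (Fin N) (Fin N) (AdeleRing (𝓞 K) K)).map
          fun a => InfiniteAdeleRing.ringEquiv_mixedSpace K a.1) k l‖) =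
      ((r : ℝ≥0) : ℝ) * (∑ k, ∑ l, ‖(((L⁻¹ : GL (Fin N) (AdeleRing (𝓞 K) K)) :
        Matrix (Fin N) (Fin N) (AdeleRing (𝓞 K) K)).map
          fun a => InfiniteAdeleRing.ringEquiv_mixedSpace K a.1) k l‖) := by
  have hinv : ((L * (posRealScalar N K r)⁻¹)⁻¹ : GL (Fin N) (AdeleRing (𝓞 K) K)) = posRealScalar N K r * L⁻¹ := by
    rw [_root_.mul_inv_rev, inv_inv]
  have hentry : ∀ k l : Fin N,
      ((((L * (posRealScalar N K r)⁻¹)⁻¹ : GL (Fin N) (AdeleRing (𝓞 K) K)) :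
          Matrix (Fin N) (Fin N) (AdeleRing (𝓞 K) K)).map
          (fun a => InfiniteAdeleRing.ringEquiv_mixedSpace K a.1)) k l =
        ((r : ℝ≥0) : ℝ) • (((L⁻¹ : GL (Fin N) (AdeleRing (𝓞 K) K)) :
          Matrix (Fin N) (Fin N) (AdeleRing (𝓞 K) K)).map
          (fun a => InfiniteAdeleRing.ringEquiv_mixedSpace K a.1)) k l := by
    intro k l
    rw [hinv, Matrix.map_apply, Matrix.map_apply, Units.val_mul]
    have hP : ((posRealScalar N K r : GL (Fin N) (AdeleRing (𝓞 K) K)) : Matrix (Fin N) (Fin N) (AdeleRing (𝓞 K) K)) =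
        (Matrix.diagonal fun _ => ((posRealIdele K r : (AdeleRing (𝓞 K) K)ˣ) : AdeleRing (𝓞 K) K)) := rfl
    rw [hP, Matrix.diagonal_mul,
      show ∀ a b : AdeleRing (𝓞 K) K, (a * b).1 = a.1 * b.1 from fun _ _ => rfl, posRealIdele_fst, map_mul,
      ringEquiv_mixedSpace_realToInfiniteAdele, ← Algebra.smul_def]
  calc (∑ k, ∑ l, ‖((((L * (posRealScalar N K r)⁻¹)⁻¹ : GL (Fin N) (AdeleRing (𝓞 K) K)) :
          Matrix (Fin N) (Fin N) (AdeleRing (𝓞 K) K)).map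
            fun a => InfiniteAdeleRing.ringEquiv_mixedSpace K a.1) k l‖)
      = ∑ k, ∑ l, ((r : ℝ≥0) : ℝ) * ‖(((L⁻¹ : GL (Fin N) (AdeleRing (𝓞 K) K)) :
          Matrix (Fin N) (Fin N) (AdeleRing (𝓞 K) K)).map
            fun a => InfiniteAdeleRing.ringEquiv_mixedSpace K a.1) k l‖ :=
        Finset.sum_congr rfl fun k _ => Finset.sum_congr rfl fun l _ => by
          rw [hentry k l, _root_.norm_smul, Real.norm_eq_abs, NNReal.abs_eq]
    _ = _ := by simp only [Finset.mul_sum]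

/-! ## §3 The tail decays along the ray -/

/-- **THE THETA TAIL DECAYS ALONG THE ARCHIMEDEAN RAY**: under the hypotheses of §1 for `L` (with
`G ≥ G(L)`, `G > 0`), for every `r > 0` and `0 ≤ θ ≤ k`,
`Σ_{ξ ≠ 0} |Ψ(ξ L z(r)⁻¹)| ≤ r^θ · M G^θ · Σ_{ξ ≠ 0, ξ_f ∈ C'} ‖ξ_∞‖^{-θ}` — the sum of `|Ψ((ξ L)/r)|` over
non-zero rational vectors is `O(r^θ)` as `r → 0`, with the same lattice constant for all `r`. [cite: Weil1965, n° 48 Lemme 21] -/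
theorem tsum_enorm_vecMul_tail_ray_le {Ψ : (Fin N → AdeleRing (𝓞 K) K) → ℂ} {k : ℕ} {M : ℝ}
    (hM0 : 0 ≤ M) (hM : ∀ x, ‖Ψ x‖ ≤ M * (1 + ‖vecInfinitePart K N x‖) ^ (-(k : ℝ)))
    {Cf : Set (Fin N → FiniteAdeleRing (𝓞 K) K)} (hCf : ∀ x, vecFinitePart K N x ∉ Cf → Ψ x = 0)
    {C' : Set (Fin N → FiniteAdeleRing (𝓞 K) K)} (L : GL (Fin N) (AdeleRing (𝓞 K) K))
    (hL : ∀ v : Fin N → K,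
      vecFinitePart K N (ratVec K v ᵥ* (L : Matrix (Fin N) (Fin N) (AdeleRing (𝓞 K) K))) ∈ Cf →
        vecFinitePart K N (ratVec K v) ∈ C')
    {G : ℝ} (hG0 : 0 < G)
    (hGL : (∑ k, ∑ l, ‖(((L⁻¹ : GL (Fin N) (AdeleRing (𝓞 K) K)) :
          Matrix (Fin N) (Fin N) (AdeleRing (𝓞 K) K)).map
            fun a => InfiniteAdeleRing.ringEquiv_mixedSpace K a.1) k l‖) ≤ G)
    {θ : ℝ} (hθ0 : 0 ≤ θ) (hθk : θ ≤ k) (r : ℝ≥0ˣ) :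
    ∑' v : ↥{v : Fin N → K | v ≠ 0},
        (‖Ψ (ratVec K (v : Fin N → K) ᵥ*
          ((L * (posRealScalar N K r)⁻¹ : GL (Fin N) (AdeleRing (𝓞 K) K)) :
            Matrix (Fin N) (Fin N) (AdeleRing (𝓞 K) K)))‖ₑ : ℝ≥0∞) ≤
      ENNReal.ofReal (((r : ℝ≥0) : ℝ) ^ θ) * (ENNReal.ofReal (M * G⁻¹ ^ (-θ)) *
        ∑' v : ↥{v : Fin N → K | v ≠ 0 ∧ vecFinitePart K N (ratVec K v) ∈ C'},
          ENNReal.ofReal (‖vecInfinitePart K N (ratVec K (v : Fin N → K))‖ ^ (-θ))) := by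
  have hr0 : (0 : ℝ) < ((r : ℝ≥0) : ℝ) := NNReal.coe_pos.2 (Units.ne_zero r |>.bot_lt)
  -- hypotheses of §1 for `L_r = L z(r)⁻¹`, with `G(L_r) ≤ r G`
  have hL' : ∀ v : Fin N → K,
      vecFinitePart K N (ratVec K v ᵥ* ((L * (posRealScalar N K r)⁻¹ : GL (Fin N) (AdeleRing (𝓞 K) K)) :
        Matrix (Fin N) (Fin N) (AdeleRing (𝓞 K) K))) ∈ Cf → vecFinitePart K N (ratVec K v) ∈ C' := fun v hv => by
    rw [vecFinitePart_vecMul_mul_posRealScalar_inv] at hv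
    exact hL v hv
  have hG' : (∑ k, ∑ l, ‖((((L * (posRealScalar N K r)⁻¹)⁻¹ : GL (Fin N) (AdeleRing (𝓞 K) K)) :
      Matrix (Fin N) (Fin N) (AdeleRing (𝓞 K) K)).map
        fun a => InfiniteAdeleRing.ringEquiv_mixedSpace K a.1) k l‖) ≤ ((r : ℝ≥0) : ℝ) * G := by
    rw [sum_norm_inv_arch_mul_posRealScalar_inv]
    exact mul_le_mul_of_nonneg_left hGL hr0.le
  have h := tsum_enorm_vecMul_tail_le_of_decay K hM0 hM hCf (L * (posRealScalar N K r)⁻¹) hL'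
    (mul_pos hr0 hG0) hG' hθ0 hθk
  refine h.trans (le_of_eq ?_)
  -- `M (rG)⁻¹^{-θ} = r^θ · M G⁻¹^{-θ}`
  rw [← mul_assoc, ← ENNReal.ofReal_mul (Real.rpow_nonneg hr0.le θ)]
  congr 2
  rw [mul_inv, Real.mul_rpow (inv_nonneg.2 hr0.le) (inv_nonneg.2 hG0.le), Real.inv_rpow hr0.le,
    Real.rpow_neg hr0.le, inv_inv]
  ring

/-! ## §4 Uniformly for finite parts in a compact set: the polynomial height bound times `r^θ` -/

/-- **THE THETA TAIL ALONG THE RAY, UNIFORMLY IN `L`** (finite parts in a compact set): for `Ψ` with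
`|Ψ(x)| ≤ M (1 + ‖x_∞‖)^{-k}` vanishing unless `x_f ∈ C_f` (`C_f` compact), a compact `𝒴 ⊆ GL_N(𝔸_K^∞)` and
`N [K:ℚ] < θ ≤ k`, there is `B < ∞` with
`Σ_{ξ ≠ 0} |Ψ(ξ L z(r)⁻¹)| ≤ r^θ · B · (1 ⊔ N² H_∞(L))^θ` for every `L ∈ GL_N(𝔸_K)` with `L_f ∈ 𝒴` and every `r > 0`
(★ `exists_tsum_enorm_vecMul_le_archHeight_rpow` for the tail, with the ray factor `r^θ`).
[cite: GodementJacquetLNM260, §11; Weil1965, n° 48 Lemme 21] -/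
theorem exists_tsum_enorm_vecMul_tail_ray_le_archHeight_rpow {Ψ : (Fin N → AdeleRing (𝓞 K) K) → ℂ} {k : ℕ} {M : ℝ}
    (hM0 : 0 ≤ M) (hM : ∀ x, ‖Ψ x‖ ≤ M * (1 + ‖vecInfinitePart K N x‖) ^ (-(k : ℝ)))
    {Cf : Set (Fin N → FiniteAdeleRing (𝓞 K) K)} (hCfc : IsCompact Cf)
    (hCf : ∀ x, vecFinitePart K N x ∉ Cf → Ψ x = 0)
    {𝒴 : Set (GL (Fin N) (FiniteAdeleRing (𝓞 K) K))} (h𝒴 : IsCompact 𝒴)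
    {θ : ℝ} (hθ : (N : ℝ) * Module.finrank ℚ K < θ) (hθk : θ ≤ k) :
    ∃ B : ℝ≥0∞, B ≠ ⊤ ∧ ∀ L : GL (Fin N) (AdeleRing (𝓞 K) K), GLn.sndHom N K L ∈ 𝒴 → ∀ r : ℝ≥0ˣ,
      ∑' v : ↥{v : Fin N → K | v ≠ 0},
          (‖Ψ (ratVec K (v : Fin N → K) ᵥ*
            ((L * (posRealScalar N K r)⁻¹ : GL (Fin N) (AdeleRing (𝓞 K) K)) :
              Matrix (Fin N) (Fin N) (AdeleRing (𝓞 K) K)))‖ₑ : ℝ≥0∞) ≤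
        ENNReal.ofReal (((r : ℝ≥0) : ℝ) ^ θ) *
          (B * ENNReal.ofReal ((max 1 ((N : ℝ) ^ 2 * (GLn.archHeight N K L : ℝ))) ^ θ)) := by
  have hθ0 : 0 ≤ θ := le_trans (by positivity) hθ.le
  obtain ⟨C', hC'c, hC'⟩ := exists_isCompact_vecFinitePart_mem K hCfc h𝒴
  -- the lattice sum at `L = 1`
  set Z : ℝ≥0∞ := ∑' v : ↥{v : Fin N → K | v ≠ 0 ∧ vecFinitePart K N (ratVec K v) ∈ C'},
    ENNReal.ofReal (‖vecInfinitePart K N (ratVec K (v : Fin N → K))‖ ^ (-θ)) with hZ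
  have hZtop : Z < ⊤ := by
    have h := tsum_norm_vecInfinitePart_rpow_neg_lt_top K (n := N) (1 : GL (Fin N) (AdeleRing (𝓞 K) K)) hC'c hθ
    have hS : {v : Fin N → K | v ≠ 0 ∧ vecFinitePart K N (ratVec K v ᵥ*
        ((1 : GL (Fin N) (AdeleRing (𝓞 K) K)) : Matrix (Fin N) (Fin N) (AdeleRing (𝓞 K) K))) ∈ C'} =
        {v : Fin N → K | v ≠ 0 ∧ vecFinitePart K N (ratVec K v) ∈ C'} := by
      ext v
      simp only [Matrix.GeneralLinearGroup.coe_one, Matrix.vecMul_one, mem_setOf_eq]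
    rw [hZ, ← tsum_congr_set_coe (fun v : Fin N → K =>
      ENNReal.ofReal (‖vecInfinitePart K N (ratVec K v)‖ ^ (-θ))) hS]
    simpa only [Matrix.GeneralLinearGroup.coe_one, Matrix.vecMul_one] using h
  refine ⟨ENNReal.ofReal M * Z, ENNReal.mul_ne_top ENNReal.ofReal_ne_top hZtop.ne, fun L hL r => ?_⟩
  set G : ℝ := max 1 ((N : ℝ) ^ 2 * (GLn.archHeight N K L : ℝ)) with hG
  have hG1 : 1 ≤ G := le_max_left _ _
  have hG0 : 0 < G := one_pos.trans_le hG1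
  have hGL := (sum_norm_inv_arch_le_mul_archHeight K L).trans (le_max_right 1 _)
  have hmain := tsum_enorm_vecMul_tail_ray_le K hM0 hM hCf L (hC' L hL) hG0 hGL hθ0 hθk r
  refine hmain.trans (le_of_eq ?_)
  have hGθ : G⁻¹ ^ (-θ) = G ^ θ := by
    rw [Real.inv_rpow hG0.le, ← Real.rpow_neg hG0.le, neg_neg]
  rw [hGθ, ENNReal.ofReal_mul hM0, mul_assoc, mul_assoc, mul_comm (ENNReal.ofReal (G ^ θ)) Z]

end Literature.NumberTheory.Automorphic

end
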